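import Literature.AlgebraicGeometry.ShimuraVarieties.UnitaryShimuraCurveHeckeDescent
import Literature.AlgebraicGeometry.ShimuraVarieties.UnitaryShimuraCurveRecordEmpty
import Literature.AlgebraicGeometry.Morphisms.ClopenPieceOfCoproduct
import HarnessLib

/-!
# Every connected component of the complex fibre of a unitary Shimura CURVE model contains a special (CM) point
# ([Deligne 1979] 2.1.2–2.1.3: the pieces `Γ_q∖𝔻` are connected; [Milne 2005] Lemma 13.5 ∕ §12 «special points»)

Topic `AlgebraicGeometry/ShimuraVarieties`; namespace `Literature.AlgebraicGeometry.ShimuraVarieties.UnitaryCanonicalModel.RecordSystemGS`.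
THEOREMS ONLY (no definition, no named fact, no instance, no `sorry`; net Literature debt 0).  Cell `hodgecm-mathlib` (D-0151), FLOOR 0, P6
door (E) of `stub_RGD`, E6 step 8 — **E6-γ brick (G1) «COMPONENT COVERAGE»**: the descent `ℂ → Fᵢ` of the `𝒪_F`-action (★ B-γ
`forall_gal_comp_eq_of_forall_exists_fieldPoint`) asks for ONE field-valued point per connected component of `X_ℂ` at which the Galois
conjugates agree; the E6-γ argument supplies the agreement at SPECIAL points `[τw, aK]`, `w ∈ L²` (CM isogeny + rigidity, ★ p847080 ∕ p847121),
and THIS file supplies the special point in every component.  `--supports stmt-HodgeConjecture-24832`, count-neutral; HC_CM is proved only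
modulo the printed citations until rung 0 closes.

For a curve record system `S : RecordSystemGS L J⋆ τ K₀` (★ `UnitaryShimuraCurveRecord`) and a small level `K`:
**`exists_specialPoint_pt_mem_connectedComponent`** — for every point `x` of the complex curve `(M_K)_τ = M_K ⊗_{L,τ} ℂ` there are
  `w ∈ L²` with `τw` negative and an adelic `a` such that the complex point `[τw, aK]` (read in `(M_K)_τ` through (F2a) `pts` and
  ★ `AlgPoints.baseChangeEquiv`) lies in the connected component of `x`.
Proof: by (F2c) `pieces` the complex curve is a colimit cofan of the pieces `X_q`, each geometrically irreducible (★ `IsSmoothProjective`),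
hence irreducible, hence connected; the legs cover (★ `Morphisms.exists_eq_of_isColimit_cofan` on the underlying schemes, ★ `isColimit_cofan_left`),
so `x = ι_q(y)`; the image of `ι_q` is preconnected and contains both `x` and `ι_q(unif_q(τw)) = [τw, g_q K]` for any `w ∈ L²` with `τw` in the
(nonempty, ★ `negCone_nonempty`; open) negative cone — such `w` exist because `τ(L)` is dense in `ℂ` (★ `exists_embedding_mem_negCone`).

## References
* [Deligne1979ShimuraVarieties] P. Deligne, *Variétés de Shimura* (1979), 2.1.2–2.1.3.
* [Milne2005ShimuraVarieties] J. S. Milne, *Introduction to Shimura varieties* (2005), §5 Lemma 5.13 p. 57, §13 Lemma 13.5 p. 118.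
* [GortzWedhorn2020] U. Görtz, T. Wedhorn, *Algebraic Geometry I*, 2nd ed. (2020), §(3.5) Example 3.11 (disjoint unions).
-/

set_option autoImplicit false

noncomputable section

open Matrix NumberField CategoryTheory CategoryTheory.Limits AlgebraicGeometry Topology
open Literature.NumberTheory.Automorphic.Liu2021.AppendixC (C5.OpenCompactSubgroup C5.SmallLevel)
open Literature.NumberTheory.Automorphic.UnitaryGroup (finAdelic rational rationalToFinAdelic arithmeticLevel)
open Literature.AlgebraicGeometry.Motives (ComplexPoints AlgPoints)

namespace Literature.AlgebraicGeometry.ShimuraVarieties.UnitaryCanonicalModel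

variable {L : Type} [Field L] [NumberField L] [IsCMField L] {Jstar : Matrix (Fin 2) (Fin 2) L} {τ : L →+* ℂ}
  {K₀ : C5.OpenCompactSubgroup ↥(finAdelic (↥(maximalRealSubfield L)) L (IsCMField.complexConj L) 2 Jstar)}

namespace RecordSystemGS

/-- **Every connected component of the complex curve `(M_K)_τ` contains a special point `[τw, aK]`, `w ∈ L²`**
([Deligne1979ShimuraVarieties] 2.1.2–2.1.3: `(M_K)_τ = ∐_q Γ_q∖𝔻` with connected pieces uniformised by `v ↦ [v, g_q K]`; special points are
dense in each piece since `τ(L)` is dense in `ℂ`).  The special point is read in `(M_K)_τ` through (F2a) `pts` and ★ `AlgPoints.baseChangeEquiv`,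
and «lies in the component» is stated on underlying points (`AlgPoints.pt`, Mathlib `connectedComponent`) — the shape consumed by ★ B-γ
`forall_gal_comp_eq_of_forall_exists_fieldPoint`. [cite: Deligne1979ShimuraVarieties, 2.1.2–2.1.3] [cite: Milne2005ShimuraVarieties, §13 Lemma 13.5 p. 118] -/
theorem exists_specialPoint_pt_mem_connectedComponent (S : RecordSystemGS L Jstar τ K₀) (K : C5.SmallLevel K₀)
    (x : ↥((Motives.baseChangeHom τ).obj (S.M.obj K)).left) :
    letI : Algebra L ℂ := τ.toAlgebra
    ∃ (w : Fin 2 → L) (hw : (fun i => τ (w i)) ∈ negCone (Jstar.map τ))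
      (a : ↥(finAdelic (↥(maximalRealSubfield L)) L (IsCMField.complexConj L) 2 Jstar)),
      (AlgPoints.baseChangeEquiv τ (S.M.obj K)
          ((S.pts K).symm (ShimuraSetGS.mk L Jstar τ K.1.1 (fun i => τ (w i)) hw a))).pt ∈ connectedComponent x := by
  letI : Algebra L ℂ := τ.toAlgebra
  -- (F2c): the complex curve is the coproduct of its pieces
  obtain ⟨g, -, X, ι, hcolim, B, hB⟩ := S.pieces K
  obtain ⟨hc⟩ := Morphisms.isColimit_cofan_left hcolim
  -- the legs cover: `x = ι_q y`
  obtain ⟨q, y, hy⟩ := Morphisms.exists_eq_of_isColimit_cofan hc x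
  -- a special vector in the negative cone (`τ(L)` dense in `ℂ`, the cone open and nonempty)
  obtain ⟨v₀, hv₀⟩ := S.negCone_nonempty
  obtain ⟨w, hw⟩ := exists_embedding_mem_negCone Jstar τ hv₀
  refine ⟨w, hw, g q, ?_⟩
  -- `[τw, g_q K] = ι_q (unif_q (τw))`
  rw [← (hB q).2.2 _ hw, AlgPoints.pt_map]
  -- the piece is geometrically irreducible, so the image of `ι_q` is preconnected and contains `x`
  haveI := (B q).isSmoothProjective.geometricallyIrreducible
  haveI : IrreducibleSpace ↥(X q).left := GeometricallyIrreducible.irreducibleSpace_of_subsingleton (X q).hom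
  have hpre : _root_.IsPreconnected (Set.range fun z : ↥(X q).left => (ι q).left z) := by
    rw [← Set.image_univ]
    exact (IrreducibleSpace.isIrreducible_univ ↥(X q).left).isPreirreducible.isPreconnected.image _
      (ι q).left.continuous.continuousOn
  exact hpre.subset_connectedComponent ⟨y, hy⟩ ⟨_, rfl⟩

end RecordSystemGS

end Literature.AlgebraicGeometry.ShimuraVarieties.UnitaryCanonicalModel

end
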